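import Summits.CriticalPhenomena.SAWScalingLimit.Theorems.SAWCircleScreeningScreeningRecursionMarkov
import HarnessLib

/-!
# Screening recursion for `SAWCircleScreening`, part VIII: the exact screen

Route `SAWCircleScreening` of `CriticalPhenomena/SAWScalingLimit`, support item
`ScreeningRecursion` (stmt-CriticalPhenomena-5468). A circle `C(c, r)` crossed exactly once by the
critical SAW is an EXACT Markov screen: conditionally on the prefix `α` up to the crossing edge
`(x, y)`, the suffix is the critical SAW from `y` to `b` of `(Ω₀ ∖ K_s)_δ`, where the *screen
data* `K_s = B(c, r) ∖ chords` (chords = closed lattice edges with both endpoints at distance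
`≥ r` from `c`) do not depend on the near data `K ⊆ B̄(c, ρ)`, `ρ < r - δ` — this is the lattice
engine of the route's card (Kesten's bridge decomposition in radial form).

* `weight_split_gen`, `law_split_gen` — the cylinder factorisation of part I for a general
  support condition `C` (here: prefix `α` AND suffix outside `B(c, r)`);
* `transport_T1_gen` — the `T1` transport for any new near data containing the mesh points of
  `α ∖ {last}` (covers the Markov and the screen instances);
* `subset_screenData`, `le_dist_of_mem_meshVertices_screen` — `K ⊆ K_s`; mesh vertices of
  `Ω₀ ∖ K_s` inside nothing: they are at distance `≥ r` from `c`;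
* `screen_T2`, `law_screen` — the exact screen identity
  `law (Ω₀∖K) {α ≼ γ, suffix outside, suffix ∈ T} = law (Ω₀∖K) {α ≼ γ, suffix outside} ·
   law (Ω₀∖K_s) {support ∈ T}`.

Folklore (Kesten 1963; Madras–Slade 1993 §4.2, radial variant). Tree anchors: parts I, IV, VII.
-/

noncomputable section

open Set Metric Complex MeasureTheory
open scoped ENNReal
open Literature.Probability.LatticeModels
open Literature.Probability.RandomPlanarGeometry
open Literature.Probability.RandomPlanarGeometry.SAW

namespace Summit.CriticalPhenomena.SAWScalingLimit.Theorems.ScreeningRecursion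

variable {Ω Ω' Ω₀ K : Set ℂ} {δ : ℝ} {a v b : Site 2}

/-! ## Cylinder factorisation for a general support condition -/

/-- **Generalised cylinder factorisation (weights).** As `weight_cylinder_split` (part I), with
the cylinder `{pre ≼ γ}` replaced by any condition `C` on supports such that the `C`-walks of
`Ω_δ` from `a` to `b` are exactly the concatenations of `pre` with the SAWs of `Ω'_δ` from `v` to
`b` (`TC`, `T1`, `T2`). [folklore] -/
theorem weight_split_gen (pre : List (Site 2)) (C : List (Site 2) → Prop)
    (T1 : ∀ β' : DomainSAW Ω' δ v b, ∃ γ : DomainSAW Ω δ a b,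
      γ.walk.support = pre.dropLast ++ β'.walk.support)
    (TC : ∀ β' : DomainSAW Ω' δ v b, C (pre.dropLast ++ β'.walk.support))
    (T2 : ∀ γ : DomainSAW Ω δ a b, C γ.walk.support →
      ∃ β' : DomainSAW Ω' δ v b, γ.walk.support = pre.dropLast ++ β'.walk.support)
    (T : Set (List (Site 2))) :
    weight Ω δ a b {γ | C γ.walk.support ∧ γ.walk.support.drop (pre.length - 1) ∈ T} =
      ENNReal.ofReal (criticalFugacity ^ (pre.length - 1)) *
        weight Ω' δ v b {β' | β'.walk.support ∈ T} := by
  classical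
  choose ι hι using T1
  have hinj : Function.Injective ι := by
    intro β₁ β₂ h
    apply DomainSAW.ext_support
    have := hι β₁
    rw [h, hι β₂] at this
    exact List.append_cancel_left this.symm
  have hlen : ∀ β', (ι β').length = (pre.length - 1) + β'.length := by
    intro β'
    have h1 := congrArg List.length (hι β')
    rw [SimpleGraph.Walk.length_support, List.length_append, List.length_dropLast,
      SimpleGraph.Walk.length_support] at h1
    show (ι β').walk.length = pre.length - 1 + β'.walk.length
    omega
  set S : Set (DomainSAW Ω δ a b) :=
    {γ | C γ.walk.support ∧ γ.walk.support.drop (pre.length - 1) ∈ T} with hS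
  have hmemS : ∀ β', ι β' ∈ S ↔ β'.walk.support ∈ T := by
    intro β'
    simp only [hS, mem_setOf_eq, hι β', drop_dropLast_append]
    exact ⟨fun h => h.2, fun h => ⟨TC β', h⟩⟩
  have hrange : ∀ γ ∈ S, γ ∈ Set.range ι := by
    intro γ hγ
    obtain ⟨β', hβ'⟩ := T2 γ hγ.1
    refine ⟨β', DomainSAW.ext_support ?_⟩
    rw [hι β', hβ']
  rw [weight_apply_eq_tsum_indicator, weight_apply_eq_tsum_indicator, ← ENNReal.tsum_mul_left]
  have hsupp : Function.support
      (S.indicator fun γ : DomainSAW Ω δ a b => ENNReal.ofReal (criticalFugacity ^ γ.length)) ⊆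
      Set.range ι := fun γ hγ => hrange γ (Set.mem_of_indicator_ne_zero hγ)
  rw [← hinj.tsum_eq hsupp]
  refine tsum_congr fun β' => ?_
  set S' : Set (DomainSAW Ω' δ v b) := {β' | β'.walk.support ∈ T} with hS'
  by_cases hT : β'.walk.support ∈ T
  · have hT' : β' ∈ S' := hT
    rw [indicator_of_mem ((hmemS β').2 hT), indicator_of_mem hT',
      hlen β', pow_add, ENNReal.ofReal_mul (pow_nonneg ?_ _)]
    exact inv_nonneg.2 (Real.iInf_nonneg fun n => Real.rpow_nonneg (Nat.cast_nonneg _) _)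
  · have hT' : β' ∉ S' := hT
    rw [indicator_of_notMem (fun h => hT ((hmemS β').1 h)), indicator_of_notMem hT', mul_zero]

/-- **Generalised cylinder factorisation (laws).** Under `TC`, `T1`, `T2` and finiteness of the
right factor: `law Ω {C γ ∧ suffix ∈ T} = law Ω {C γ} · law Ω' {support ∈ T}`. [folklore] -/
theorem law_split_gen (pre : List (Site 2)) (C : List (Site 2) → Prop)
    (T1 : ∀ β' : DomainSAW Ω' δ v b, ∃ γ : DomainSAW Ω δ a b,
      γ.walk.support = pre.dropLast ++ β'.walk.support)
    (TC : ∀ β' : DomainSAW Ω' δ v b, C (pre.dropLast ++ β'.walk.support))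
    (T2 : ∀ γ : DomainSAW Ω δ a b, C γ.walk.support →
      ∃ β' : DomainSAW Ω' δ v b, γ.walk.support = pre.dropLast ++ β'.walk.support)
    (hfin : weight Ω' δ v b univ ≠ ⊤) (T : Set (List (Site 2))) :
    law Ω δ a b {γ | C γ.walk.support ∧ γ.walk.support.drop (pre.length - 1) ∈ T} =
      law Ω δ a b {γ | C γ.walk.support} * law Ω' δ v b {β' | β'.walk.support ∈ T} := by
  have huniv := weight_split_gen pre C T1 TC T2 univ
  simp only [mem_univ, and_true, setOf_true] at huniv
  rw [law_apply_eq_inv_mul_weight, law_apply_eq_inv_mul_weight, law_apply_eq_inv_mul_weight,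
    weight_split_gen pre C T1 TC T2 T, huniv]
  set Z := weight Ω δ a b univ
  set Z' := weight Ω' δ v b univ
  set cst := ENNReal.ofReal (criticalFugacity ^ (pre.length - 1))
  set W := weight Ω' δ v b {β' | β'.walk.support ∈ T}
  by_cases hZ' : Z' = 0
  · have hW : W = 0 := le_antisymm (le_trans (measure_mono (subset_univ _)) hZ'.le) bot_le
    simp [hW]
  · calc Z⁻¹ * (cst * W) = Z⁻¹ * (cst * (Z' * Z'⁻¹) * W) := by
          rw [ENNReal.mul_inv_cancel hZ' hfin, mul_one]
      _ = Z⁻¹ * (cst * Z') * (Z'⁻¹ * W) := by ring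

/-! ## The `T1` transport for general new near data -/

/-- **Transport `T1`, general form.** Let `α` be a self-avoiding prefix of `(Ω₀ ∖ K)_δ` from `a`
to `v`, and `K'` any near data with `Ω₀ ∖ K' ⊆ Ω₀ ∖ K` and containing the mesh points of the
vertices of `α` other than `v`. Then every SAW of `(Ω₀ ∖ K')_δ` from `v` to `b` concatenates
with `α` to a SAW of `(Ω₀ ∖ K)_δ` from `a` to `b` (given `b ∈ (Ω₀ ∖ K)_δ`). [folklore] -/
theorem transport_T1_gen (α : (discreteDomainGraph (Ω₀ \ K) δ).Walk a v) (hα : α.IsPath)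
    (hb : b ∈ meshDomain (Ω₀ \ K) δ) {K' : Set ℂ} (hsub : Ω₀ \ K' ⊆ Ω₀ \ K)
    (hαK' : ∀ w ∈ α.support.dropLast, meshPoint δ w ∈ K') (β' : DomainSAW (Ω₀ \ K') δ v b) :
    ∃ γ : DomainSAW (Ω₀ \ K) δ a b, γ.walk.support = α.support.dropLast ++ β'.walk.support := by
  classical
  by_cases hnil : β'.walk.Nil
  · have hvb : v = b := hnil.eq
    subst hvb
    refine ⟨⟨α, hα⟩, ?_⟩
    rw [SimpleGraph.Walk.nil_iff_support_eq.1 hnil]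
    exact support_eq_dropLast_append α
  · have hdomK' : ∀ w ∈ β'.walk.support, w ∈ meshDomain (Ω₀ \ K') δ := fun w hw =>
      mem_meshDomain_of_mem_support β'.walk hnil hw
    have hvertK' : ∀ w ∈ β'.walk.support, w ∈ meshVertices (Ω₀ \ K') δ := fun w hw =>
      meshDomain_subset_meshVertices _ _ (hdomK' w hw)
    have hvK' : v ∈ meshVertices (Ω₀ \ K') δ := hvertK' v (SimpleGraph.Walk.start_mem_support _)
    have hvert : ∀ w ∈ β'.walk.support, w ∈ meshDomain (Ω₀ \ K) δ := by
      intro w hw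
      obtain ⟨hw', hr⟩ := reachable_meshVertexGraph_of_walk (β'.walk.takeUntil w hw) hvK'
      obtain ⟨hb', hrb⟩ := reachable_meshVertexGraph_of_walk β'.walk hvK'
      have h' := reachable_mono_domain hsub hw' hb' (hr.symm.trans hrb)
      exact mem_meshDomain_of_reachable_meshVertexGraph hb (hsub hb') (hsub hw') h'.symm
    have hedges : ∀ e ∈ β'.walk.edges, e ∈ (discreteDomainGraph (Ω₀ \ K) δ).edgeSet := by
      intro e he
      induction e using Sym2.ind with
      | h x y =>
        rw [SimpleGraph.mem_edgeSet]
        have hadj : (discreteDomainGraph (Ω₀ \ K') δ).Adj x y :=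
          SimpleGraph.Walk.adj_of_mem_edges _ he
        obtain ⟨hm, -, -⟩ := discreteDomainGraph_adj_iff.1 hadj
        rw [meshGraph_adj_iff] at hm
        exact discreteDomainGraph_adj_iff.2
          ⟨meshGraph_adj_iff.2 ⟨hm.1, hm.2.trans (closure_mono hsub)⟩,
          hvert x (SimpleGraph.Walk.fst_mem_support_of_mem_edges _ he),
          hvert y (SimpleGraph.Walk.snd_mem_support_of_mem_edges _ he)⟩
    set β'' := β'.walk.transfer (discreteDomainGraph (Ω₀ \ K) δ) hedges with hβ''
    have hβ''supp : β''.support = β'.walk.support := SimpleGraph.Walk.support_transfer _ _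
    refine ⟨⟨α.append β'', ?_⟩, ?_⟩
    · rw [SimpleGraph.Walk.isPath_def, SimpleGraph.Walk.support_append, hβ''supp]
      refine List.Nodup.append hα.support_nodup ?_ ?_
      · exact ((SimpleGraph.Walk.isPath_def _).1 β'.isPath).sublist (List.tail_sublist _)
      · intro w hwα hwβ
        by_cases hwv : w = v
        · have hnd := (SimpleGraph.Walk.isPath_def _).1 β'.isPath
          rw [← SimpleGraph.Walk.cons_tail_support, List.nodup_cons] at hnd
          exact hnd.1 (hwv ▸ hwβ)
        · have hwK' : meshPoint δ w ∈ K' := by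
            refine hαK' w ?_
            rw [support_eq_dropLast_append α, List.mem_append, List.mem_singleton] at hwα
            exact hwα.resolve_right hwv
          exact (hvertK' w (List.mem_of_mem_tail hwβ)).2 hwK'
    · show (α.append β'').support = α.support.dropLast ++ β'.walk.support
      rw [SimpleGraph.Walk.support_append, hβ''supp]
      conv_lhs => rw [support_eq_dropLast_append α]
      rw [List.append_assoc]
      congr 1
      rw [← SimpleGraph.Walk.cons_tail_support β'.walk]
      rfl

/-! ## The screen data -/

section Screen

variable {c : ℂ} {r ρ : ℝ}

/-- A point of a chord (closed lattice edge with both endpoints at distance `≥ r` from `c`) is at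
distance `> r - δ`... precisely `≥ r - δ`; we record: `ρ < r - δ` puts it outside `B̄(c, ρ)`.
[folklore] -/
theorem not_mem_closedBall_of_mem_chord (hδ : 0 ≤ δ) (hρ : ρ < r - δ) {x y : Site 2}
    (hxy : (zdGraph 2).Adj x y) (hx : r ≤ dist (meshPoint δ x) c) {z : ℂ}
    (hz : z ∈ segment ℝ (meshPoint δ x) (meshPoint δ y)) : z ∉ closedBall c ρ := by
  intro hzρ
  have h1 : dist z (meshPoint δ x) ≤ δ := dist_le_of_mem_segment_of_adj hδ hxy hz
  have h2 := dist_triangle (meshPoint δ x) z c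
  rw [dist_comm (meshPoint δ x) z] at h2
  have h3 := mem_closedBall.1 hzρ
  linarith

/-- **The screen data contain the near data**: `K ⊆ B̄(c, ρ)`, `ρ < r - δ` give `K ⊆ K_s`.
[folklore] -/
theorem subset_screenData (hδ : 0 ≤ δ) (hρ : ρ < r - δ) (hK : K ⊆ closedBall c ρ) :
    K ⊆ ball c r \ {z | ∃ x y : Site 2, (zdGraph 2).Adj x y ∧ r ≤ dist (meshPoint δ x) c ∧
      r ≤ dist (meshPoint δ y) c ∧ z ∈ segment ℝ (meshPoint δ x) (meshPoint δ y)} := by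
  intro z hz
  refine ⟨mem_ball.2 (lt_of_le_of_lt (mem_closedBall.1 (hK hz)) (by linarith)), ?_⟩
  rintro ⟨x, y, hxy, hx, -, hzs⟩
  exact not_mem_closedBall_of_mem_chord hδ hρ hxy hx hzs (hK hz)

/-- A lattice point whose mesh point is not in the screen data `K_s` and lies in the ball
`B(c, r)` is impossible: mesh points inside the ball lie on a chord only as its endpoints, which
are outside. Hence **mesh vertices of `Ω₀ ∖ K_s` are at distance `≥ r` from `c`**. [folklore] -/
theorem le_dist_of_not_mem_screenData (hδ : δ ≠ 0) {w : Site 2}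
    (hw : meshPoint δ w ∉ ball c r \ {z | ∃ x y : Site 2, (zdGraph 2).Adj x y ∧
      r ≤ dist (meshPoint δ x) c ∧ r ≤ dist (meshPoint δ y) c ∧
      z ∈ segment ℝ (meshPoint δ x) (meshPoint δ y)}) : r ≤ dist (meshPoint δ w) c := by
  by_contra hlt
  push Not at hlt
  apply hw
  refine ⟨mem_ball.2 hlt, ?_⟩
  rintro ⟨x, y, hxy, hx, hy, hws⟩
  rcases eq_or_eq_of_meshPoint_mem_segment hδ hxy hws with rfl | rfl
  · linarith
  · linarith

/-- **Exact screen, `T2`.** Let `Ω₀` be flat at `c` up to radius `ρ₀`, `r + δ < ρ₀`, and `α` a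
walk of `(Ω₀ ∖ K)_δ` from `a` to `y`. Every SAW `γ` of
`(Ω₀ ∖ K)_δ` from `a` to `b` starting with `α` whose vertices after `α` are at distance `≥ r`
from `c` continues as a SAW of `(Ω₀ ∖ K_s)_δ` from `y` (given `b ∈ (Ω₀ ∖ K_s)_δ`). [folklore] -/
theorem screen_T2 {u : ℂ} {ρ₀ : ℝ} (hflat : Ω₀ ∩ ball c ρ₀ = {z | 0 < ((z - c) * u).im} ∩ ball c ρ₀)
    (hδ : 0 < δ) (hrρ₀ : r + δ < ρ₀)
    (α : (discreteDomainGraph (Ω₀ \ K) δ).Walk a v) {Ks : Set ℂ}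
    (hKs : Ks = ball c r \ {z | ∃ x y : Site 2, (zdGraph 2).Adj x y ∧ r ≤ dist (meshPoint δ x) c ∧
      r ≤ dist (meshPoint δ y) c ∧ z ∈ segment ℝ (meshPoint δ x) (meshPoint δ y)})
    (hb' : b ∈ meshDomain (Ω₀ \ Ks) δ) (γ : DomainSAW (Ω₀ \ K) δ a b)
    (hpre : α.support <+: γ.walk.support)
    (hout : ∀ w ∈ γ.walk.support.drop α.length, r ≤ dist (meshPoint δ w) c) :
    ∃ β' : DomainSAW (Ω₀ \ Ks) δ v b, γ.walk.support = α.support.dropLast ++ β'.walk.support := by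
  classical
  set n := α.length with hn
  set αd := α.support.dropLast with hαd
  have hαsupp : α.support = αd ++ [v] := support_eq_dropLast_append α
  have hαdlen : αd.length = n := by
    have h1 : α.support.length = n + 1 := SimpleGraph.Walk.length_support α
    rw [hαd, List.length_dropLast, h1]; rfl
  obtain ⟨rest, hrest⟩ := hpre
  have hsupp : γ.walk.support = αd ++ (v :: rest) := by
    rw [← hrest, hαsupp, List.append_assoc]; rfl
  have hnodup : (αd ++ (v :: rest)).Nodup := hsupp ▸ γ.isPath.support_nodup
  have hrestnd : (v :: rest).Nodup := (List.nodup_append.1 hnodup).2.1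
  have hnlen : n ≤ γ.walk.length := by
    have h1 : γ.walk.support.length = γ.walk.length + 1 := SimpleGraph.Walk.length_support _
    rw [hsupp, List.length_append, List.length_cons, hαdlen] at h1
    omega
  have hdrop : γ.walk.support.drop n = v :: rest := by
    rw [hsupp, ← hαdlen, List.drop_left]
  have hout' : ∀ w ∈ v :: rest, r ≤ dist (meshPoint δ w) c := fun w hw => hout w (hdrop ▸ hw)
  set β₀ := γ.walk.drop n with hβ₀
  have hβ₀supp : β₀.support = v :: rest := by
    rw [hβ₀, SimpleGraph.Walk.drop_support_eq_support_drop_min, min_eq_left hnlen, hdrop]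
  have hv : γ.walk.getVert n = v := by
    have h := head?_support β₀
    rw [hβ₀supp] at h
    simpa using h.symm
  set β₁ : (discreteDomainGraph (Ω₀ \ K) δ).Walk v b := β₀.copy hv rfl with hβ₁
  have hβ₁supp : β₁.support = v :: rest := by rw [hβ₁, SimpleGraph.Walk.support_copy, hβ₀supp]
  by_cases hnil : β₁.Nil
  · have hvb : v = b := hnil.eq
    subst hvb
    refine ⟨⟨SimpleGraph.Walk.nil, SimpleGraph.Walk.IsPath.nil⟩, ?_⟩
    have : v :: rest = [v] := hβ₁supp ▸ SimpleGraph.Walk.nil_iff_support_eq.1 hnil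
    rw [hsupp, this]
    rfl
  have hKsball : Ks ⊆ ball c r := by rw [hKs]; exact Set.sdiff_subset
  -- vertices of `β₁`: in `Ω₀ ∖ K`, at distance `≥ r`, hence mesh vertices of `Ω₀ ∖ Ks`
  have hVert : ∀ w ∈ β₁.support, w ∈ meshVertices (Ω₀ \ Ks) δ := by
    intro w hw
    have hwdom : w ∈ meshDomain (Ω₀ \ K) δ := mem_meshDomain_of_mem_support β₁ hnil hw
    refine ⟨(meshDomain_subset_meshVertices _ _ hwdom).1, fun hwKs => ?_⟩
    have := mem_ball.1 (hKsball hwKs)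
    linarith [hout' w (hβ₁supp ▸ hw)]
  -- closed edges of `β₁` lie in the closure of `Ω₀ ∖ Ks`
  have hEdge : ∀ e ∈ β₁.edges, ∀ x' y', e = s(x', y') →
      segment ℝ (meshPoint δ x') (meshPoint δ y') ⊆ closure (Ω₀ \ Ks) := by
    intro e he x' y' hexy
    subst hexy
    have hadj : (discreteDomainGraph (Ω₀ \ K) δ).Adj x' y' := SimpleGraph.Walk.adj_of_mem_edges _ he
    obtain ⟨hm, hxdom, hydom⟩ := discreteDomainGraph_adj_iff.1 hadj
    rw [meshGraph_adj_iff] at hm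
    have hx's : x' ∈ β₁.support := SimpleGraph.Walk.fst_mem_support_of_mem_edges _ he
    have hy's : y' ∈ β₁.support := SimpleGraph.Walk.snd_mem_support_of_mem_edges _ he
    have hxr : r ≤ dist (meshPoint δ x') c := hout' x' (hβ₁supp ▸ hx's)
    have hyr : r ≤ dist (meshPoint δ y') c := hout' y' (hβ₁supp ▸ hy's)
    have hxΩ : meshPoint δ x' ∈ Ω₀ := (meshDomain_subset_meshVertices _ _ hxdom).1
    have hyΩ : meshPoint δ y' ∈ Ω₀ := (meshDomain_subset_meshVertices _ _ hydom).1
    intro z hz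
    -- `z` is not in the screen data: it lies on the chord `[x', y']`
    have hzKs : z ∉ Ks := by
      rw [hKs]
      rintro ⟨-, hz2⟩
      exact hz2 ⟨x', y', hm.1, hxr, hyr, hz⟩
    have hzx : dist z (meshPoint δ x') ≤ δ := dist_le_of_mem_segment_of_adj hδ.le hm.1 hz
    by_cases hzc : r < dist z c
    · -- far from the ball: a neighbourhood of `z` misses `K ∪ Ks`
      have hU : IsOpen (closedBall c r)ᶜ := isClosed_closedBall.isOpen_compl
      have hzU : z ∈ (closedBall c r)ᶜ := fun h => (not_le.2 hzc) (mem_closedBall.1 h)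
      have h1 : z ∈ closure ((closedBall c r)ᶜ ∩ (Ω₀ \ K)) := hU.inter_closure ⟨hzU, hm.2 hz⟩
      refine closure_mono ?_ h1
      rintro w ⟨hw1, hw2⟩
      exact ⟨hw2.1, fun hwKs => hw1 (ball_subset_closedBall (hKsball hwKs))⟩
    · -- near the ball: in the flat zone, the chord lies in `Ω₀` (positive height is convex)
      push Not at hzc
      refine subset_closure ⟨?_, hzKs⟩
      have hxball : meshPoint δ x' ∈ ball c ρ₀ := mem_ball.2 (by
        have := dist_triangle (meshPoint δ x') z c; rw [dist_comm (meshPoint δ x') z] at this; linarith)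
      have hyz : dist (meshPoint δ y') z ≤ δ := by
        have h1 := dist_add_dist_of_mem_segment hz
        have h2 := dist_meshPoint_le_of_adj hδ.le hm.1
        rw [dist_comm] ; linarith [dist_nonneg (x := meshPoint δ x') (y := z)]
      have hyball : meshPoint δ y' ∈ ball c ρ₀ := mem_ball.2 (by
        have := dist_triangle (meshPoint δ y') z c; linarith)
      have hzball : z ∈ ball c ρ₀ := mem_ball.2 (by linarith)
      have hxh := (mem_iff_of_flat hflat hxball).1 hxΩ
      have hyh := (mem_iff_of_flat hflat hyball).1 hyΩ
      refine (mem_iff_of_flat hflat hzball).2 ?_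
      rw [segment_eq_image] at hz
      obtain ⟨θ, ⟨hθ0, hθ1⟩, rfl⟩ := hz
      have : ((1 - θ) • meshPoint δ x' + θ • meshPoint δ y' - c) * u =
          ((1 - θ : ℝ) : ℂ) * ((meshPoint δ x' - c) * u) + (θ : ℂ) * ((meshPoint δ y' - c) * u) := by
        simp only [Complex.real_smul]; push_cast; ring
      rw [this, Complex.add_im, Complex.im_ofReal_mul, Complex.im_ofReal_mul]
      rcases hθ0.eq_or_lt with rfl | hθpos
      · simp only [sub_zero, one_mul, zero_mul, add_zero]; exact hxh
      · have : 0 ≤ (1 - θ) * ((meshPoint δ x' - c) * u).im := mul_nonneg (by linarith) hxh.le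
        nlinarith
  -- every vertex of `β₁` is joined to `b` in the mesh graph of `Ω₀ ∖ Ks`
  have hvKs : v ∈ meshVertices (Ω₀ \ Ks) δ := hVert v (SimpleGraph.Walk.start_mem_support _)
  have hDom : ∀ w ∈ β₁.support, w ∈ meshDomain (Ω₀ \ Ks) δ := by
    intro w hw
    obtain ⟨hb1, hvb⟩ := reachable_meshVertexGraph_of_walk_of_subset β₁ hvKs
      (fun w hw => let h := hVert w hw; ⟨h.1, h.2⟩) hEdge
    obtain ⟨hw1, hvw⟩ := reachable_meshVertexGraph_of_walk_of_subset (β₁.takeUntil w hw) hvKs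
      (fun t ht => let h := hVert t (SimpleGraph.Walk.support_takeUntil_subset_support _ _ ht);
        ⟨h.1, h.2⟩)
      (fun e he => hEdge e (SimpleGraph.Walk.edges_takeUntil_subset_edges _ _ he))
    exact mem_meshDomain_of_reachable_meshVertexGraph hb' hb1 hw1 (hvb.symm.trans hvw)
  have hedges : ∀ e ∈ β₁.edges, e ∈ (discreteDomainGraph (Ω₀ \ Ks) δ).edgeSet := by
    intro e he
    induction e using Sym2.ind with
    | h x y =>
      rw [SimpleGraph.mem_edgeSet]
      have hadj : (discreteDomainGraph (Ω₀ \ K) δ).Adj x y := SimpleGraph.Walk.adj_of_mem_edges _ he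
      obtain ⟨hm, -, -⟩ := discreteDomainGraph_adj_iff.1 hadj
      rw [meshGraph_adj_iff] at hm
      exact discreteDomainGraph_adj_iff.2 ⟨meshGraph_adj_iff.2 ⟨hm.1, hEdge _ he x y rfl⟩,
        hDom x (SimpleGraph.Walk.fst_mem_support_of_mem_edges _ he),
        hDom y (SimpleGraph.Walk.snd_mem_support_of_mem_edges _ he)⟩
  refine ⟨⟨β₁.transfer _ hedges, ?_⟩, ?_⟩
  · rw [SimpleGraph.Walk.isPath_def, SimpleGraph.Walk.support_transfer, hβ₁supp]
    exact hrestnd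
  · show γ.walk.support = αd ++ (β₁.transfer _ hedges).support
    rw [SimpleGraph.Walk.support_transfer, hβ₁supp, hsupp]

end Screen

end Summit.CriticalPhenomena.SAWScalingLimit.Theorems.ScreeningRecursion

end
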